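import Literature.Algebra.Homology.LaurentCechGradedSubquotient
import Literature.Algebra.Homology.LaurentCechSaturationInvariance
import Literature.Algebra.Homology.LaurentCechGradedModuleGlobalSections
import Literature.Algebra.Homology.LaurentCechHilbertPolynomial
import HarnessLib

/-!
# Čech complexes of subquotients `N' ⧸ N` only see the saturations `N̄ ⊆ N̄'` (Hartshorne II Ex. 5.10)

Hartshorne, *Algebraic Geometry*, II Ex. 5.10 (b): two graded submodules define the same subsheaf of
`F_e~` iff they have the same saturation. `LaurentCechSaturationInvariance` proves the Čech form for
SUBMODULES and QUOTIENTS: `Č_d(K) ≅ Č_d(K')` for `K ≤ K' ≤ K̄`. This file records the version for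
SUBQUOTIENTS `N' ⧸ N` (ideal sheaves `𝓘_{Z ⊂ X} = (N' ⧸ N)~`, complex `LaurentCech.subquot e N N' h d`):

* **`LaurentCech.nonempty_subquot_iso_of_le_sat`** — for `N ≤ M ≤ N̄`, `N' ≤ M' ≤ N̄'` (`N ≤ N'`,
  `M ≤ M'`): `Č_d(N' ⧸ N) ≅ Č_d(M' ⧸ M)` for every `d` (a commuting square of isomorphisms
  `Č(N) ≅ Č(M)`, `Č(N') ≅ Č(M')` induces an isomorphism of cokernels);
* `LaurentCech.nonempty_subquot_iso_sat` — in particular `Č_d(N' ⧸ N) ≅ Č_d(N̄' ⧸ N̄)`;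
  `LaurentCech.nonempty_subquot_iso_of_sat_eq` — pairs with the same saturations (the same closed
  subschemes `Z ⊆ X`) have isomorphic Čech complexes: the cohomology of `𝓘_{Z ⊂ X}(d)` does not depend
  on the chosen homogeneous ideals;
* `LaurentCech.finrank_homology_subquot_eq_of_sat_eq`, `LaurentCech.isZero_homology_subquot_iff_of_sat_eq`,
  `LaurentCech.eulerCharSubquot_eq_of_sat_eq` — hence the same cohomology ranks, vanishing and
  `χ`-polynomial.

## References

* [Hartshorne1977] R. Hartshorne, *Algebraic Geometry*, GTM 52, Springer 1977, II Ex. 5.10 (p. 125),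
  II Cor. 5.16 (p. 119).
-/

noncomputable section

open CategoryTheory CategoryTheory.Limits

universe u

namespace Literature.Algebra.Homology

namespace LaurentCech

open OrderedCech TopCohomology

section AnyRing

variable {A : Type u} [CommRing A] {r : ℕ} {J : Type} (e : J → ℤ)

/-- **`Č_d(N' ⧸ N) ≅ Č_d(M' ⧸ M)` for `N ≤ M ≤ N̄` and `N' ≤ M' ≤ N̄'`**: the inclusions
`Č_d(N) ≅ Č_d(M)`, `Č_d(N') ≅ Č_d(M')` are isomorphisms (saturation invariance) forming a commuting
square with `Č(N) ↪ Č(N')`, `Č(M) ↪ Č(M')`, hence induce an isomorphism of the cokernel complexes.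
[cite: Hartshorne1977, II Ex. 5.10 (b) (p. 125)] -/
theorem nonempty_subquot_iso_of_le_sat {N N' M M' : Submodule (P A r) (J → P A r)} (h : N ≤ N')
    (h' : M ≤ M') (hNM : N ≤ M) (hN'M' : N' ≤ M') (hM : M ≤ sat N) (hM' : M' ≤ sat N') (d : ℤ) :
    Nonempty (subquot e N N' h d ≅ subquot e M M' h' d) := by
  haveI := isIso_inclusion_of_le_saturation e hNM (le_sat_iff.1 hM) d
  haveI := isIso_inclusion_of_le_saturation e hN'M' (le_sat_iff.1 hM') d
  exact ⟨cokernel.mapIso (inclusion e N N' h d) (inclusion e M M' h' d)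
    (asIso (inclusion e N M hNM d)) (asIso (inclusion e N' M' hN'M' d))
    (by rw [asIso_hom, asIso_hom, inclusion_comp, inclusion_comp])⟩

/-- **`Č_d(N' ⧸ N) ≅ Č_d(N̄' ⧸ N̄)`**: the Čech complex of a subquotient is that of the pair of
saturations. [cite: Hartshorne1977, II Ex. 5.10 (b) (p. 125)] -/
theorem nonempty_subquot_iso_sat {N N' : Submodule (P A r) (J → P A r)} (h : N ≤ N') (d : ℤ) :
    Nonempty (subquot e N N' h d ≅ subquot e (sat N) (sat N') (sat_mono h) d) :=
  nonempty_subquot_iso_of_le_sat e h (sat_mono h) (le_sat N) (le_sat N') le_rfl le_rfl d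

/-- **Pairs with the same saturations have isomorphic Čech complexes**: if `N̄ = M̄` and `N̄' = M̄'`
(`N ≤ N'`, `M ≤ M'`) — i.e. the pairs define the same closed subschemes `Z ⊆ X`, the same ideal
sheaf `𝓘_{Z ⊂ X}` — then `Č_d(N' ⧸ N) ≅ Č_d(M' ⧸ M)` for all `d`.
[cite: Hartshorne1977, II Ex. 5.10 (b) (p. 125)] [cite: Hartshorne1977, II Cor. 5.16 (p. 119)] -/
theorem nonempty_subquot_iso_of_sat_eq {N N' M M' : Submodule (P A r) (J → P A r)} (h : N ≤ N')
    (h' : M ≤ M') (hs : sat N = sat M) (hs' : sat N' = sat M') (d : ℤ) :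
    Nonempty (subquot e N N' h d ≅ subquot e M M' h' d) := by
  obtain ⟨I₁⟩ := nonempty_subquot_iso_sat e h d
  obtain ⟨I₂⟩ := nonempty_subquot_iso_sat e h' d
  obtain ⟨I₃⟩ := nonempty_subquot_iso_of_le_sat e (sat_mono h) (sat_mono h') hs.le hs'.le
    (by rw [sat_sat]; exact hs.ge) (by rw [sat_sat]; exact hs'.ge) d
  exact ⟨I₁ ≪≫ I₃ ≪≫ I₂.symm⟩

/-- Hence the cohomology modules agree in rank … [cite: Hartshorne1977, II Ex. 5.10 (b) (p. 125)] -/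
theorem finrank_homology_subquot_eq_of_sat_eq {N N' M M' : Submodule (P A r) (J → P A r)}
    (h : N ≤ N') (h' : M ≤ M') (hs : sat N = sat M) (hs' : sat N' = sat M') (d i : ℤ) :
    Module.finrank A ((subquot e N N' h d).homology i) =
      Module.finrank A ((subquot e M M' h' d).homology i) := by
  obtain ⟨I⟩ := nonempty_subquot_iso_of_sat_eq e h h' hs hs' d
  exact ((HomologicalComplex.homologyFunctor (ModuleCat.{u} A) (ComplexShape.up ℤ) i).mapIso
    I).toLinearEquiv.finrank_eq

/-- … and vanish together. [cite: Hartshorne1977, II Ex. 5.10 (b) (p. 125)] -/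
theorem isZero_homology_subquot_iff_of_sat_eq {N N' M M' : Submodule (P A r) (J → P A r)}
    (h : N ≤ N') (h' : M ≤ M') (hs : sat N = sat M) (hs' : sat N' = sat M') (d i : ℤ) :
    IsZero ((subquot e N N' h d).homology i) ↔ IsZero ((subquot e M M' h' d).homology i) := by
  obtain ⟨I⟩ := nonempty_subquot_iso_of_sat_eq e h h' hs hs' d
  let I' := (HomologicalComplex.homologyFunctor (ModuleCat.{u} A) (ComplexShape.up ℤ) i).mapIso I
  exact ⟨fun hz => hz.of_iso I'.symm, fun hz => hz.of_iso I'⟩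

/-- In particular `H^i(Č_d(N' ⧸ N)) ≅ H^i(Č_d(N̄' ⧸ N̄))` in rank.
[cite: Hartshorne1977, II Ex. 5.10 (b) (p. 125)] -/
theorem finrank_homology_subquot_eq_sat {N N' : Submodule (P A r) (J → P A r)} (h : N ≤ N')
    (d i : ℤ) :
    Module.finrank A ((subquot e N N' h d).homology i) =
      Module.finrank A ((subquot e (sat N) (sat N') (sat_mono h) d).homology i) :=
  finrank_homology_subquot_eq_of_sat_eq e h (sat_mono h) (sat_sat N).symm (sat_sat N').symm d i

end AnyRing

section Field

variable {k : Type u} [Field k] {r : ℕ} {J : Type} (e : J → ℤ)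

/-- **Pairs with the same saturations have the same Euler characteristics** `χ(Č_n(N' ⧸ N))`, hence
the same `χ`-polynomial. [cite: Hartshorne1977, II Ex. 5.10 (b) (p. 125)]
[cite: Hartshorne1977, III Ex. 5.1 (p. 230)] -/
theorem eulerCharSubquot_eq_of_sat_eq {N N' M M' : Submodule (P k r) (J → P k r)} (h : N ≤ N')
    (h' : M ≤ M') (hs : sat N = sat M) (hs' : sat N' = sat M') (n : ℤ) :
    eulerCharSubquot e N N' h n = eulerCharSubquot e M M' h' n := by
  rw [eulerCharSubquot_def, eulerCharSubquot_def]
  exact Finset.sum_congr rfl fun q _ => by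
    rw [finrank_homology_subquot_eq_of_sat_eq e h h' hs hs' n q]

/-- The `χ`-polynomial hypothesis transfers between pairs with the same saturations.
[cite: Hartshorne1977, II Ex. 5.10 (b) (p. 125)] [cite: Hartshorne1977, III Ex. 5.2 (p. 230)] -/
theorem hilbertPolynomial_subquot_of_sat_eq {N N' M M' : Submodule (P k r) (J → P k r)} (h : N ≤ N')
    (h' : M ≤ M') (hs : sat N = sat M) (hs' : sat N' = sat M') {Q : Polynomial ℚ}
    (hQ : ∀ n : ℤ, ((∑ q ∈ Finset.range (r + 1), (-1 : ℤ) ^ q *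
      (Module.finrank k ((subquot e N N' h n).homology q) : ℤ) : ℤ) : ℚ) = Q.eval (n : ℚ)) (n : ℤ) :
    ((∑ q ∈ Finset.range (r + 1), (-1 : ℤ) ^ q *
      (Module.finrank k ((subquot e M M' h' n).homology q) : ℤ) : ℤ) : ℚ) = Q.eval (n : ℚ) := by
  rw [← hQ n]
  congr 1
  exact Finset.sum_congr rfl fun q _ => by
    rw [finrank_homology_subquot_eq_of_sat_eq e h h' hs hs' n q]

end Field

end LaurentCech

end Literature.Algebra.Homology

end
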